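import Literature.MathematicalPhysics.QuantumFieldTheory.Balaban1983to89.B15
import Literature.MathematicalPhysics.QuantumFieldTheory.Balaban1983to89.B15Prop1Minimum
import Literature.MathematicalPhysics.QuantumFieldTheory.Balaban1983to89.B16Sect1Wilson

/-!
# `Balaban1983to89.B15Prop1FromModel` — T. Bałaban, *Large field renormalization. I. The basic step of the 𝐑 operation*,
Commun. Math. Phys. **122** (1989) 175–202 [Balaban1989LargeFieldI] («[IV]»), **Proposition 1** p. 194 — the statement of
record `B15.Prop1Printed` INHABITED: it holds for every carrier `P : B15.LFVar` whose instances are REALISED by the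
abstract Hilbert model of its only printed proof, [Balaban1989LargeFieldII] («[LF-II]») pp. 358–359 (tree:
`B16Prop1IVAssembly` (r13), `B15Prop1Minimum` (r12)).

statement-level skeleton of published theorems with citation tags; proofs where landed; nothing here is a claim about
the Yang–Mills mass gap

Cell pub-ymgap, HUMAN RULING D-0062 (Track A full width), seat `pub-ymgap-dag-n12-b` (-b FIRST-MISSING-ESTIMATE of DAG
node N12 = [B15]; statement of record `Dag.B15_main`, leaf `DagBinding.B15Leaf`, conjunct `p1 : B15.Prop1Printed W.LF`).
dag-lead NODE-TABLE v1 row n12: *«0 inhabitation theorems (grep `theorem.*Prop1Printed` over 91 `B15*.lean`: 0)»* — this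
file supplies the first.  PDFs held: `paper:balaban1989-cmp122-large-field-i` (journal page = PDF page + 174; p. 194 =
PDF 20), `paper:balaban1989-cmp122-large-field-ii` (journal page = PDF page + 354; p. 359 = PDF 5); both text layers re-read
by this seat (2026-08-25).

THE PRINT.  [IV] p. 194 [PDF 20]: *«Consider the function V_k↾_Λ → A(U_{k,Z}(V_k)). (1.77) It is defined on configurations
V_k satisfying mild regularity conditions, e.g., |∂V_k − 1| < a₁ on Z. The function is invariant with respect to the
group of all gauge transformations defined on Λ, hence it is natural to consider it on orbits of this group. We look for
a minimal orbit. We will prove later the following theorem.  Proposition 1. For a configuration V_k↾_{Z∩Λᶜ}, satisfying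
the regularity condition |∂V_k − 1| < ε on the domain Z ∩ Λᶜ, for ε > 0 sufficiently small, there exists exactly one
critical orbit of the function (1.77). An element of the orbit is a minimum of the function, and is denoted by V_Λ =
V_Λ(V_k↾_{Z∩Λᶜ}). It satisfies the regularity condition |V_Λ(∂p′) − 1| < B₅M⁵ε for p′ ∈ Λ. (1.78)  The orbit-valued
function V_Λ(V_k↾_{Z∩Λᶜ}) has an analytic extension …»*; p. 195: *«The constant B₅ is determined by the geometry of the
problem, more precisely by the condition (i).»*  p. 193 [PDF 19] (the extension the proof fixes): *«the field V_k↾_{Z∩Λᶜ}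
has an extension … satisfying the regularity condition |∂V_k − 1| < O(1)M²ε.»*  [LF-II] p. 359 [PDF 5]: *«Now we prove
Proposition 1 [IV]. … We fix such an extension, and we consider the variational problem for the function V′↾_Λ →
A(U_{k,Z}(V′V_k)) … Fixing the gauge G₀ for V′ we get a small configuration, and we can write V′ = exp iB′. We expand
the function with respect to B′ … Now the condition for a critical configuration is the equation ⟨δB′, H*_{1,k}J_{k,Z}⟩
+ ⟨δB′, H*_{1,k}Δ₁H_{1,k}B′⟩ + ⟨δB′, H*_{1,k}((δ/δA)V)(H_{1,k}B′)⟩ = 0 (1.12) … Denote by P₀ the projection onto the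
subspace of B′ satisfying the gauge condition B′↾_{G₀} = 0. By the inequality (1.9) the operator P₀H*_{1,k}Δ₁H_{1,k}P₀
is positive, hence invertible on this subspace, and the inverse is bounded by γ₀⁻¹2d(100M)⁵. … Using Proposition 4 [15]
and the fixed point theorem for contractive mappings, we can easily prove that the above equation has exactly one
solution, which has a bound equal to twice a bound of the right-hand side of the equation, i.e., it can be bounded by
2γ₀⁻¹2d(100M)⁵B₃²4ε_k. This proves the existence and the uniqueness statements of Proposition 1 [IV], and the bound
(1.78) [IV]. The above equations, bounds and statements are valid for 𝔤ᶜ-valued fields, hence the existence of the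
analytic extension follows immediately, and Proposition 1 [IV] is proved. It is proved for ε_k instead of a general ε,
but the generalization is obvious.»*

STATE OF THE TREE BEFORE THIS FILE.  Every printed clause of the p. 359 argument is a kernel theorem in r13's/r12's
ABSTRACT REAL-HILBERT MODEL — `E` the gauge-fixed fields `B′` on `Λ`, `F` the fields on the fine lattice, `P₀` the gauge
projection, `H = H_{1,k}`, `Hst = H*_{1,k}`, `Δ₁`, `dV = (δ/δA)V`, `J = J_{k,Z}`: existence and uniqueness in the ball
*«twice a bound of the right-hand side»* with the inverse DERIVED from the (1.9) positivity constant `c`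
(`B16Prop1IVAssembly.prop1IV_model_of_pos`), the minimum clause on every ball of the Proposition-4 chart
(`B15Prop1Minimum.le_of_critical` / `lt_of_critical_of_ne`), the analytic extension in the complex model
(`B16Prop1IVFromProp4.prop1IV_of_ineq19_prop4`).  What had NO theorem: the statement of record itself,
`B15.Prop1Printed P` over the abstract carrier `B15.LFVar` (SKELETON row B15.Prop1: *«head unchanged … the B15 statement
`Prop1Printed` itself is not discharged by the model»*).

WHAT THIS FILE PROVES (theorems only; Mathlib + `B15` + `B15Prop1Minimum` (hence `B16Prop1IVAssembly`); no `sorry`, no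
definition, no `… : Prop` fact; axioms standard).
§1 `critical_unique_of_chart` — in the model: two (1.12)-critical gauge-fixed configurations of a ball `‖B′‖ ≤ r` of the
   Proposition-4 chart (`h₁r ≤ ρ`) COINCIDE (r12's strict-minimum inequality read both ways) — the uniqueness of the
   critical orbit on the whole chart, not only on the existence ball of the contraction.
§2 **`prop1Printed_of_model`** — `B15.Prop1Printed P` for every `P : B15.LFVar` equipped, at every instance `i` and
   boundary datum `W : P.Bdry i` (= `V_k↾_{Z∩Λᶜ}`), with p. 359 model data and the DICTIONARY saying that `P`'s predicates
   are the model's: (d1) `rep i W : P.Orbit i → E i`, injective, = the G₀-gauge representative `B′` of an orbit relative to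
   the fixed extension of `W` (*«Fixing the gauge G₀ for V′ … we can write V′ = exp iB′»*), with values in the gauge-fixed
   ball `‖B′‖ ≤ r i` of the chart and ONTO it; (d2) `P.IsCritical i W O ↔` (1.12) for `rep i W O`; (d3) `P.IsMinimum i W O`
   whenever `rep i W O` minimises the function over all orbits; (d4) the deviation `P.dev i O = sup_{p′∈Λ}|V_Λ(∂p′) − 1|`
   bounded by `a·‖B′‖ + b·M²·ε` (chart + the p. 193 extension *«|∂V_k − 1| < O(1)M²ε»*); (m1) the (1.9) positivity on
   the gauge subspace with constant `γ/(M i)⁵` (print: `γ₀/(2d(100M)⁵)`); (m2) `‖H‖ ≤ h₁`, `‖H*‖ ≤ hst`, adjointness;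
   (m3) Proposition 4 [15]: `dV 0 = 0` and an `ℓ i`-Lipschitz bound on the ball of radius `ρ i ≥ h₁·r i`, with the
   contraction smallness `(M i)⁵/γ · hst · ℓ i · h₁ ≤ ½` (r13's `hsmall`); (m4) the current is small on regular data,
   `P.Regular i ε W → ‖J i W‖ ≤ cJ·ε` (print: `B₃²4ε_k` with `‖H*‖ ≤ B₃`); (m5) the function `A i W` with first
   variation (1.12) (r12's `hA`); (x) the analytic-extension clause `P.AnalyticExt i ε W` SUPPLIED for regular data below
   its own threshold `eA i` (its model proof is the complex twin `B16Prop1IVFromProp4.prop1IV_of_ineq19_prop4`; not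
   re-derived here).  CONSTANTS, in the printed quantifier order: `B₅ := 2·a·hst·cJ/γ + b + 1` FIRST (instance-independent,
   *«determined by the geometry of the problem»*), then per instance the threshold `e0 i := min (eA i) (r i/(K i + 1))`,
   `K i := 2(M i)⁵hst·cJ/γ` (*«for ε > 0 sufficiently small»*: the existence ball `‖B′‖ ≤ K i·ε` must lie in the chart).
§3 `prop1_at_instance` — the same conclusion at ONE instance with the constants displayed (for the knit seat n12-a).

HONEST SCOPE (located, nothing repaired).  (i) As in r13's/r12's files, neither `A(U_{k,Z}(·))`, the chart `exp iB′`,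
`H_{1,k}`, `Δ₁(ζ₀)`, `V`, `J_{k,Z}` nor an `LFVar` of record is CONSTRUCTED: the theorem discharges `B15.Prop1Printed` for
ANY carrier realised by such data; building the carrier of record (NODE 00, `PrintedCarriers15.LF`) and discharging
(d1)–(d4), (m1)–(m5), (x) on it is the knit (-a) ∕ node00-def work.  (ii) UNIQUENESS is among the orbits of the chart
(d1) (`‖B′‖ ≤ r i`, `h₁r i ≤ ρ i`: the Proposition-4 chart, cf. `B15Prop1Minimum` HONEST SCOPE (ii)); print's domain of
(1.77), *«mild regularity conditions, e.g., |∂V_k − 1| < a₁ on Z»*, is a priori wider when `a₁` is not tied to `M` — the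
p. 359 contraction argument gives no more than the chart; recorded here, not resolved.  (iii) The `M`-exponent: with an
`M`-free `cJ` in (m4) the bound is `B₅M⁵ε` as printed; the ℓ² → pointwise bookkeeping that makes the honest exponent 7
(cell GAPS G-B16-02, `B16.prop1_chain_M7`) lives in DISCHARGING (m4)/(d4) on a concrete carrier, not in this file.
(iv) *«It is proved for ε_k instead of a general ε, but the generalization is obvious»*: here `ε` is general, as in the
statement of record.  NOT summit progress; count-neutral (a node discharge needs the NODE 00 pin of `W.LF`).
-/

namespace Literature.MathematicalPhysics.QuantumFieldTheory.Balaban1983to89.B15Prop1FromModel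

open scoped RealInnerProductSpace
open Literature.MathematicalPhysics.QuantumFieldTheory.Balaban1983to89

/-! ## §1 Uniqueness of the critical configuration on the whole chart (model) -/

section Model

variable {E F : Type*} [NormedAddCommGroup E] [InnerProductSpace ℝ E]
  [NormedAddCommGroup F] [InnerProductSpace ℝ F]

/-- **«exactly one critical orbit»** in the abstract model of the [LF-II] p. 359 proof, on the WHOLE Proposition-4 chart:
if `B` and `B′` are gauge-fixed (`P₀B = B`, `P₀B′ = B′`) configurations of the ball `‖·‖ ≤ r`, `h₁r ≤ ρ`, and BOTH satisfy
the criticality equation (1.12) for all gauge variations, then `B′ = B` — under the positivity (1.9) (`c‖x‖² ≤ ⟨Hx, Δ₁Hx⟩`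
on the gauge subspace), the `ℓ`-Lipschitz letter of `(δ/δA)V` on the ball of radius `ρ` (Proposition 4 [15]) and r13's
smallness `c⁻¹·hst·ℓ·h₁ ≤ ½`.  Proof: r12's strict inequality `A B < A B′` (`B15Prop1Minimum.lt_of_critical_of_ne`) read
both ways. [cite: Balaban1989LargeFieldI, Prop. 1 p.194 («there exists exactly one critical orbit»);
Balaban1989LargeFieldII, p.359 (proof of Proposition 1 [IV]), (1.9) p.358; Balaban1985Variational, Prop. 4 p.293] -/
theorem critical_unique_of_chart {P₀ : E →ₗ[ℝ] E} (H : E →ₗ[ℝ] F) (Hst : F →ₗ[ℝ] E)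
    (hadj : ∀ (x : E) (y : F), ⟪H x, y⟫ = ⟪x, Hst y⟫) (Δ₁ : F →ₗ[ℝ] F) (dV : F → F) (J : F)
    {A : E → ℝ}
    (hA : ∀ X δ : E, HasDerivAt (fun s : ℝ => A (X + s • δ))
      (⟪δ, Hst J⟫ + ⟪δ, Hst (Δ₁ (H X))⟫ + ⟪δ, Hst (dV (H X))⟫) 0)
    {c : ℝ} (hc : 0 < c) (hpos : ∀ x, P₀ x = x → c * ‖x‖ ^ 2 ≤ ⟪H x, Δ₁ (H x)⟫)
    {h₁ hst ℓ ρ r : ℝ} (hh₁ : 0 ≤ h₁) (hhst : 0 ≤ hst) (hℓ : 0 ≤ ℓ)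
    (hH : ∀ x : E, ‖H x‖ ≤ h₁ * ‖x‖) (hHst : ∀ z : F, ‖Hst z‖ ≤ hst * ‖z‖)
    (hdV : ∀ u v : F, ‖u‖ ≤ ρ → ‖v‖ ≤ ρ → ‖dV u - dV v‖ ≤ ℓ * ‖u - v‖) (hρ : h₁ * r ≤ ρ)
    (hsmall : c⁻¹ * hst * ℓ * h₁ ≤ 1 / 2) {B : E} (hBg : P₀ B = B) (hBn : ‖B‖ ≤ r)
    (hcrit : ∀ δB : E, P₀ δB = δB →
      ⟪δB, Hst J⟫ + ⟪δB, Hst (Δ₁ (H B))⟫ + ⟪δB, Hst (dV (H B))⟫ = 0)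
    {B' : E} (hB'g : P₀ B' = B') (hB'n : ‖B'‖ ≤ r)
    (hcrit' : ∀ δB : E, P₀ δB = δB →
      ⟪δB, Hst J⟫ + ⟪δB, Hst (Δ₁ (H B'))⟫ + ⟪δB, Hst (dV (H B'))⟫ = 0) : B' = B := by
  by_contra hne
  have h1 : A B < A B' :=
    B15Prop1Minimum.lt_of_critical_of_ne H Hst hadj Δ₁ dV J hA hc hpos hh₁ hhst hℓ hH hHst hdV hρ hsmall hBg
      hBn hcrit hB'g hB'n hne
  have h2 : A B' < A B :=
    B15Prop1Minimum.lt_of_critical_of_ne H Hst hadj Δ₁ dV J hA hc hpos hh₁ hhst hℓ hH hHst hdV hρ hsmall hB'g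
      hB'n hcrit' hBg hBn (Ne.symm hne)
  exact lt_asymm h1 h2

end Model

/-! ## §2 `B15.Prop1Printed` from the model -/

/-- Threshold bookkeeping (*«for ε > 0 sufficiently small»*): `ε ≤ r/(K + 1)` with `K ≥ 0`, `r > 0` gives `K·ε ≤ r` —
the existence ball of radius `K·ε` lies in the chart of radius `r`. [folklore] -/
private theorem threshold_arith {K r ε : ℝ} (hK : 0 ≤ K) (hr : 0 < r) (hε : ε ≤ r / (K + 1)) :
    K * ε ≤ r := by
  have hK1 : 0 < K + 1 := by linarith
  have hfrac : K / (K + 1) ≤ 1 := by rw [div_le_one hK1]; linarith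
  calc K * ε ≤ K * (r / (K + 1)) := mul_le_mul_of_nonneg_left hε hK
    _ = r * (K / (K + 1)) := by ring
    _ ≤ r * 1 := mul_le_mul_of_nonneg_left hfrac hr.le
    _ = r := mul_one r

/-- (1.78) bookkeeping: `a·(K·ε) + b·M²·ε < (2·a·hst·cJ/γ + b + 1)·M⁵·ε` for `K = 2M⁵hst·cJ/γ`, `M ≥ 1`, `ε > 0`,
`b ≥ 0`. [folklore] -/
private theorem dev_arith {a b hst cJ γ M ε : ℝ} (hb : 0 ≤ b) (hM : 1 ≤ M) (hε : 0 < ε) :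
    a * (2 * M ^ 5 * hst * cJ / γ * ε) + b * M ^ 2 * ε < (2 * a * hst * cJ / γ + b + 1) * M ^ 5 * ε := by
  have hM2 : M ^ 2 ≤ M ^ 5 := pow_le_pow_right₀ hM (by norm_num)
  have hM5 : 0 < M ^ 5 := by positivity
  have h1 : a * (2 * M ^ 5 * hst * cJ / γ * ε) = 2 * a * hst * cJ / γ * M ^ 5 * ε := by ring
  have h2 : b * M ^ 2 * ε ≤ b * M ^ 5 * ε :=
    mul_le_mul_of_nonneg_right (mul_le_mul_of_nonneg_left hM2 hb) hε.le
  have h3 : 0 < M ^ 5 * ε := mul_pos hM5 hε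
  have h4 : (2 * a * hst * cJ / γ + b + 1) * M ^ 5 * ε =
      2 * a * hst * cJ / γ * M ^ 5 * ε + b * M ^ 5 * ε + M ^ 5 * ε := by ring
  rw [h1, h4]
  linarith

/-- **Proposition 1 of [Balaban1989LargeFieldI], the statement of record `B15.Prop1Printed`, INHABITED on every carrier
realised by the [LF-II] p. 359 model.**  Data per instance `i : P.Inst` and boundary datum `W : P.Bdry i`
(= `V_k↾_{Z∩Λᶜ}`): real inner-product spaces `E i` (gauge-fixed fields `B′` on `Λ`, finite-dimensional) and `F i` (fields
on the fine lattice), the gauge projection `P₀ i W` (idempotent, symmetric), `H i W = H_{1,k}`, `Hst i W = H*_{1,k}`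
(adjoint pair, `‖H‖ ≤ h₁`, `‖H*‖ ≤ hst`), `Δ₁ i W`, `dV i W = (δ/δA)V` (`dV 0 = 0`, `ℓ i`-Lipschitz on the ball of radius
`ρ i` — *«Proposition 4 [15]»*), the current `J i W = J_{k,Z}` with `‖J‖ ≤ cJ·ε` on `ε`-regular data, the positivity (1.9)
on the gauge subspace with constant `γ/(M i)⁵`, the contraction smallness `(M i)⁵/γ·hst·ℓ i·h₁ ≤ ½`, the function `A i W`
of (1.77) in the chart with first variation (1.12); the dictionary `rep i W` (orbits ↔ gauge-fixed configurations of the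
chart ball `‖B′‖ ≤ r i`, `h₁·r i ≤ ρ i`), `IsCritical ↔ (1.12)`, `IsMinimum ⇐` minimiser over orbits, `dev ≤ a‖B′‖ +
bM²ε`, `1 ≤ M i`; and the analytic-extension clause supplied below its own threshold `eA i`.  Conclusion:
`B15.Prop1Printed P`, with `B₅ = 2·a·hst·cJ/γ + b + 1` and `e0 i = min (eA i) (r i/(2(M i)⁵hst·cJ/γ + 1))`.
Uses BY NAME `B16Prop1IVAssembly.prop1IV_model_of_pos` (existence, inverse from (1.9), *«twice a bound of the right-hand
side»*), `B15Prop1Minimum.le_of_critical` (minimum) and `critical_unique_of_chart` (uniqueness).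
[cite: Balaban1989LargeFieldI, Prop. 1 (1.78) p.194; Balaban1989LargeFieldII, pp.358–359 (proof of Proposition 1 [IV]);
Balaban1985Variational, Prop. 4 p.293] -/
theorem prop1Printed_of_model (P : B15.LFVar)
    {E : P.Inst → Type*} {F : P.Inst → Type*}
    [∀ i, NormedAddCommGroup (E i)] [∀ i, InnerProductSpace ℝ (E i)] [∀ i, FiniteDimensional ℝ (E i)]
    [∀ i, NormedAddCommGroup (F i)] [∀ i, InnerProductSpace ℝ (F i)]
    (P₀ : ∀ i, P.Bdry i → (E i →ₗ[ℝ] E i)) (hP2 : ∀ i W x, P₀ i W (P₀ i W x) = P₀ i W x)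
    (hPsa : ∀ i W x y, ⟪P₀ i W x, y⟫ = ⟪x, P₀ i W y⟫)
    (H : ∀ i, P.Bdry i → (E i →ₗ[ℝ] F i)) (Hst : ∀ i, P.Bdry i → (F i →ₗ[ℝ] E i))
    (hadj : ∀ i W (x : E i) (y : F i), ⟪H i W x, y⟫ = ⟪x, Hst i W y⟫)
    (Δ₁ : ∀ i, P.Bdry i → (F i →ₗ[ℝ] F i)) (dV : ∀ i, P.Bdry i → F i → F i) (J : ∀ i, P.Bdry i → F i)
    (A : ∀ i, P.Bdry i → E i → ℝ)
    {γ h₁ hst cJ a b : ℝ} (hγ : 0 < γ) (hh₁ : 0 ≤ h₁) (hhst : 0 ≤ hst) (hcJ : 0 ≤ cJ) (ha : 0 ≤ a)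
    (hb : 0 ≤ b) {ℓ ρ r eA : P.Inst → ℝ} (hℓ : ∀ i, 0 ≤ ℓ i) (hr : ∀ i, 0 < r i) (heA : ∀ i, 0 < eA i)
    (hM : ∀ i, 1 ≤ P.M i)
    (hpos : ∀ i W x, P₀ i W x = x → γ / P.M i ^ 5 * ‖x‖ ^ 2 ≤ ⟪H i W x, Δ₁ i W (H i W x)⟫)
    (hH : ∀ i W x, ‖H i W x‖ ≤ h₁ * ‖x‖) (hHst : ∀ i W z, ‖Hst i W z‖ ≤ hst * ‖z‖)
    (hdV0 : ∀ i W, dV i W 0 = 0)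
    (hdV : ∀ i W (u v : F i), ‖u‖ ≤ ρ i → ‖v‖ ≤ ρ i → ‖dV i W u - dV i W v‖ ≤ ℓ i * ‖u - v‖)
    (hρ : ∀ i, h₁ * r i ≤ ρ i) (hsmall : ∀ i, P.M i ^ 5 / γ * hst * ℓ i * h₁ ≤ 1 / 2)
    (hA : ∀ i W (X δ : E i), HasDerivAt (fun s : ℝ => A i W (X + s • δ))
      (⟪δ, Hst i W (J i W)⟫ + ⟪δ, Hst i W (Δ₁ i W (H i W X))⟫ + ⟪δ, Hst i W (dV i W (H i W X))⟫) 0)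
    (hJ : ∀ i ε W, 0 < ε → P.Regular i ε W → ‖J i W‖ ≤ cJ * ε)
    (rep : ∀ i, P.Bdry i → P.Orbit i → E i) (hrepP : ∀ i W O, P₀ i W (rep i W O) = rep i W O)
    (hrepr : ∀ i W O, ‖rep i W O‖ ≤ r i) (hrep_inj : ∀ i W, Function.Injective (rep i W))
    (hrep_surj : ∀ i W (B : E i), P₀ i W B = B → ‖B‖ ≤ r i → ∃ O, rep i W O = B)
    (hcrit : ∀ i W O, P.IsCritical i W O ↔ ∀ δB : E i, P₀ i W δB = δB →
      ⟪δB, Hst i W (J i W)⟫ + ⟪δB, Hst i W (Δ₁ i W (H i W (rep i W O)))⟫ +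
        ⟪δB, Hst i W (dV i W (H i W (rep i W O)))⟫ = 0)
    (hmin : ∀ i W O, (∀ O', A i W (rep i W O) ≤ A i W (rep i W O')) → P.IsMinimum i W O)
    (hdev : ∀ i ε W O, 0 < ε → P.Regular i ε W → P.dev i O ≤ a * ‖rep i W O‖ + b * P.M i ^ 2 * ε)
    (hAn : ∀ i ε W, 0 < ε → ε ≤ eA i → P.Regular i ε W → P.AnalyticExt i ε W) :
    B15.Prop1Printed P := by
  refine ⟨2 * a * hst * cJ / γ + b + 1, by positivity, fun i => ?_⟩
  -- the per-instance letters: positivity constant `c = γ/M⁵` of (1.9) and the radius factor `K = 2M⁵hst·cJ/γ`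
  have hM0 : 0 < P.M i := lt_of_lt_of_le one_pos (hM i)
  have hc : 0 < γ / P.M i ^ 5 := div_pos hγ (pow_pos hM0 5)
  have hcinv : (γ / P.M i ^ 5)⁻¹ = P.M i ^ 5 / γ := inv_div _ _
  have hK : 0 ≤ 2 * P.M i ^ 5 * hst * cJ / γ := by positivity
  refine ⟨min (eA i) (r i / (2 * P.M i ^ 5 * hst * cJ / γ + 1)),
    lt_min (heA i) (div_pos (hr i) (by linarith)), fun ε hε hεle W hW => ?_⟩
  have hεA : ε ≤ eA i := hεle.trans (min_le_left _ _)
  have hεK : 2 * P.M i ^ 5 * hst * cJ / γ * ε ≤ r i :=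
    threshold_arith hK (hr i) (hεle.trans (min_le_right _ _))
  -- the model hypotheses at `(i, W)`
  have hsmall' : (γ / P.M i ^ 5)⁻¹ * hst * ℓ i * h₁ ≤ 1 / 2 := by rw [hcinv]; exact hsmall i
  have hJ' : ‖J i W‖ ≤ cJ * ε := hJ i ε W hε hW
  have hball : 2 * ((γ / P.M i ^ 5)⁻¹ * hst * ‖J i W‖) ≤ 2 * P.M i ^ 5 * hst * cJ / γ * ε := by
    rw [hcinv]
    have := mul_le_mul_of_nonneg_left hJ' (mul_nonneg (div_nonneg (pow_nonneg hM0.le 5) hγ.le) hhst)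
    calc 2 * (P.M i ^ 5 / γ * hst * ‖J i W‖) ≤ 2 * (P.M i ^ 5 / γ * hst * (cJ * ε)) := by linarith
      _ = 2 * P.M i ^ 5 * hst * cJ / γ * ε := by ring
  have hballr : 2 * ((γ / P.M i ^ 5)⁻¹ * hst * ‖J i W‖) ≤ r i := hball.trans hεK
  have hρ' : h₁ * (2 * ((γ / P.M i ^ 5)⁻¹ * hst * ‖J i W‖)) ≤ ρ i :=
    (mul_le_mul_of_nonneg_left hballr hh₁).trans (hρ i)
  -- existence + «twice a bound of the right-hand side» (r13, inverse from (1.9))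
  obtain ⟨Kinv, -, hJb, B, ⟨hBg, hBn, hBcrit⟩, -⟩ :=
    B16Prop1IVAssembly.prop1IV_model_of_pos (hP2 i W) (hPsa i W) (H i W) (Hst i W) (hadj i W) (Δ₁ i W)
      (dV i W) (J i W) hc (hpos i W) (hdV0 i W) hh₁ hhst (hℓ i) (hH i W) (hHst i W) (hdV i W) hρ' hsmall'
  have hBK : ‖B‖ ≤ 2 * P.M i ^ 5 * hst * cJ / γ * ε := hBn.trans (hJb.trans hball)
  have hBr : ‖B‖ ≤ r i := hBK.trans hεK
  -- the critical configuration is (the representative of) an orbit of the chart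
  obtain ⟨O, hO⟩ := hrep_surj i W B hBg hBr
  refine ⟨O, ?_, ?_, ?_, ?_, hAn i ε W hε hεA hW⟩
  · -- critical: (1.12)
    rw [hcrit, hO]
    exact hBcrit
  · -- exactly one critical orbit (on the chart)
    intro O' hO'
    have hc' := (hcrit i W O').1 hO'
    have hEq : rep i W O' = B :=
      critical_unique_of_chart (H i W) (Hst i W) (hadj i W) (Δ₁ i W) (dV i W) (J i W) (hA i W) hc (hpos i W)
        hh₁ hhst (hℓ i) (hH i W) (hHst i W) (hdV i W) (hρ i) hsmall' hBg hBr hBcrit (hrepP i W O')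
        (hrepr i W O') hc'
    exact hrep_inj i W (hEq.trans hO.symm)
  · -- an element of the orbit is a minimum of the function (r12)
    refine hmin i W O fun O' => ?_
    rw [hO]
    exact B15Prop1Minimum.le_of_critical (H i W) (Hst i W) (hadj i W) (Δ₁ i W) (dV i W) (J i W) (hA i W) hc
      (hpos i W) hh₁ hhst (hℓ i) (hH i W) (hHst i W) (hdV i W) (hρ i) hsmall' hBg hBr hBcrit (hrepP i W O')
      (hrepr i W O')
  · -- (1.78)
    calc P.dev i O ≤ a * ‖rep i W O‖ + b * P.M i ^ 2 * ε := hdev i ε W O hε hW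
      _ ≤ a * (2 * P.M i ^ 5 * hst * cJ / γ * ε) + b * P.M i ^ 2 * ε := by
          rw [hO]; exact add_le_add (mul_le_mul_of_nonneg_left hBK ha) le_rfl
      _ < (2 * a * hst * cJ / γ + b + 1) * P.M i ^ 5 * ε := dev_arith hb (hM i) hε

/-! ## §3 The same at one instance, constants displayed (model) -/

section Instance

variable {E F : Type*} [NormedAddCommGroup E] [InnerProductSpace ℝ E]
  [NormedAddCommGroup F] [InnerProductSpace ℝ F]

/-- **Proposition 1 [IV] at ONE instance of the p. 359 model, with the constants displayed** (for the knit of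
`PrintedCarriers15.LF`): positivity (1.9) with constant `γ/M⁵` (print: `γ₀/(2d(100M)⁵)`), `M ≥ 1`, the Proposition-4
chart `‖B′‖ ≤ r`, `h₁r ≤ ρ`, and a current small enough for the existence ball to fit, `2M⁵hst/γ·‖J‖ ≤ r`.  Then there is
a gauge-fixed `B` with `‖B‖ ≤ 2M⁵hst/γ·‖J‖` (*«twice a bound of the right-hand side»*; print `2γ₀⁻¹2d(100M)⁵B₃²4ε_k`
for `‖J‖ ≤ B₃4ε_k`, `hst = B₃`) which is (1.12)-critical, is the ONLY (1.12)-critical gauge-fixed configuration of the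
whole chart ball `‖B′‖ ≤ r`, and minimises the function `A` there, strictly.  BY NAME: r13's
`B16Prop1IVAssembly.prop1IV_model_of_pos`, r12's `B15Prop1Minimum.le_of_critical`/`lt_of_critical_of_ne`, §1.
[cite: Balaban1989LargeFieldI, Prop. 1 (1.78) p.194; Balaban1989LargeFieldII, p.359 (proof of Proposition 1 [IV]), (1.9)
p.358; Balaban1985Variational, Prop. 4 p.293] -/
theorem prop1_at_instance [FiniteDimensional ℝ E] {P₀ : E →ₗ[ℝ] E} (hP2 : ∀ x, P₀ (P₀ x) = P₀ x)
    (hPsa : ∀ x y, ⟪P₀ x, y⟫ = ⟪x, P₀ y⟫) (H : E →ₗ[ℝ] F) (Hst : F →ₗ[ℝ] E)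
    (hadj : ∀ (x : E) (y : F), ⟪H x, y⟫ = ⟪x, Hst y⟫) (Δ₁ : F →ₗ[ℝ] F) (dV : F → F) (J : F)
    {A : E → ℝ}
    (hA : ∀ X δ : E, HasDerivAt (fun s : ℝ => A (X + s • δ))
      (⟪δ, Hst J⟫ + ⟪δ, Hst (Δ₁ (H X))⟫ + ⟪δ, Hst (dV (H X))⟫) 0)
    {γ M h₁ hst ℓ ρ r : ℝ} (hγ : 0 < γ) (hM : 1 ≤ M) (hh₁ : 0 ≤ h₁) (hhst : 0 ≤ hst) (hℓ : 0 ≤ ℓ)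
    (hpos : ∀ x, P₀ x = x → γ / M ^ 5 * ‖x‖ ^ 2 ≤ ⟪H x, Δ₁ (H x)⟫)
    (hH : ∀ x : E, ‖H x‖ ≤ h₁ * ‖x‖) (hHst : ∀ z : F, ‖Hst z‖ ≤ hst * ‖z‖) (hdV0 : dV 0 = 0)
    (hdV : ∀ u v : F, ‖u‖ ≤ ρ → ‖v‖ ≤ ρ → ‖dV u - dV v‖ ≤ ℓ * ‖u - v‖) (hρ : h₁ * r ≤ ρ)
    (hsmall : M ^ 5 / γ * hst * ℓ * h₁ ≤ 1 / 2) (hfit : 2 * M ^ 5 * hst / γ * ‖J‖ ≤ r) :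
    ∃ B : E, P₀ B = B ∧ ‖B‖ ≤ 2 * M ^ 5 * hst / γ * ‖J‖ ∧
      (∀ δB : E, P₀ δB = δB → ⟪δB, Hst J⟫ + ⟪δB, Hst (Δ₁ (H B))⟫ + ⟪δB, Hst (dV (H B))⟫ = 0) ∧
      (∀ B' : E, P₀ B' = B' → ‖B'‖ ≤ r →
        (∀ δB : E, P₀ δB = δB → ⟪δB, Hst J⟫ + ⟪δB, Hst (Δ₁ (H B'))⟫ + ⟪δB, Hst (dV (H B'))⟫ = 0) →
          B' = B) ∧
      (∀ B' : E, P₀ B' = B' → ‖B'‖ ≤ r → A B ≤ A B' ∧ (B' ≠ B → A B < A B')) := by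
  have hM0 : 0 < M := lt_of_lt_of_le one_pos hM
  have hc : 0 < γ / M ^ 5 := div_pos hγ (pow_pos hM0 5)
  have hcinv : (γ / M ^ 5)⁻¹ = M ^ 5 / γ := inv_div _ _
  have hsmall' : (γ / M ^ 5)⁻¹ * hst * ℓ * h₁ ≤ 1 / 2 := by rw [hcinv]; exact hsmall
  have hball : 2 * ((γ / M ^ 5)⁻¹ * hst * ‖J‖) = 2 * M ^ 5 * hst / γ * ‖J‖ := by rw [hcinv]; ring
  have hρ' : h₁ * (2 * ((γ / M ^ 5)⁻¹ * hst * ‖J‖)) ≤ ρ :=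
    (mul_le_mul_of_nonneg_left (hball.le.trans hfit) hh₁).trans hρ
  obtain ⟨Kinv, -, hJb, B, ⟨hBg, hBn, hBcrit⟩, -⟩ :=
    B16Prop1IVAssembly.prop1IV_model_of_pos hP2 hPsa H Hst hadj Δ₁ dV J hc hpos hdV0 hh₁ hhst hℓ hH hHst hdV
      hρ' hsmall'
  have hBJ : ‖B‖ ≤ 2 * M ^ 5 * hst / γ * ‖J‖ := hBn.trans (hJb.trans hball.le)
  have hBr : ‖B‖ ≤ r := hBJ.trans hfit
  refine ⟨B, hBg, hBJ, hBcrit, fun B' hB'g hB'n hc' => ?_, fun B' hB'g hB'n => ⟨?_, fun hne => ?_⟩⟩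
  · exact critical_unique_of_chart H Hst hadj Δ₁ dV J hA hc hpos hh₁ hhst hℓ hH hHst hdV hρ hsmall' hBg hBr hBcrit
      hB'g hB'n hc'
  · exact B15Prop1Minimum.le_of_critical H Hst hadj Δ₁ dV J hA hc hpos hh₁ hhst hℓ hH hHst hdV hρ hsmall' hBg hBr
      hBcrit hB'g hB'n
  · exact B15Prop1Minimum.lt_of_critical_of_ne H Hst hadj Δ₁ dV J hA hc hpos hh₁ hhst hℓ hH hHst hdV hρ hsmall'
      hBg hBr hBcrit hB'g hB'n hne

end Instance

/-! ## §4 (v1.1, append-only, 2026-08-25) The positivity input (m1) IS r13's typed (1.9) (`B16Sect1Wilson.Ineq19`, `d = 4`;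
new import), and the statement of record under the `ℓ²` reading of the current (GAPS G-B16-02) when `M ≤ M₀` is fixed -/

section Inputs

variable {E F : Type*} [NormedAddCommGroup E] [InnerProductSpace ℝ E]
  [NormedAddCommGroup F] [InnerProductSpace ℝ F]

/-- **(m1) from (1.9) AS TYPED.**  r13's leaf `B16Sect1Wilson.Ineq19 Q ‖B′‖² γ₀ d M` reads *«⟨H_{1,k}B′, Δ₁(ζ₀)H_{1,k}B′⟩ ≧
γ₀2⁻¹d⁻¹(100M)⁻⁵‖B′‖²»* (exponent `d + 1`); at `d = 4`, for every gauge-fixed `B′`, it is the positivity hypothesis `hpos` of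
`prop1Printed_of_model` ∕ `prop1_at_instance` with the instance-independent constant `γ = γ₀/(8·100⁵)`:
`γ/M⁵·‖B′‖² ≤ ⟨HB′, Δ₁HB′⟩`.  ((1.9) itself ⇐ (1.7) ∧ (1.8): r13's `B16Sect1Wilson.ineq19_of_17_18`; (1.7) from its printed
steps: this seat's `B16Ineq17MinimizerError.ineq17_of_steps`.) [cite: Balaban1989LargeFieldII, (1.9) p.358, p.359 («By
the inequality (1.9) the operator P₀H*_{1,k}Δ₁H_{1,k}P₀ is positive»)] -/
theorem hpos_of_ineq19 (P₀ : E →ₗ[ℝ] E) (H : E →ₗ[ℝ] F) (Δ₁ : F →ₗ[ℝ] F) {γ₀ M : ℝ} (hM : 0 < M)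
    (h19 : ∀ x : E, P₀ x = x → B16Sect1Wilson.Ineq19 ⟪H x, Δ₁ (H x)⟫ (‖x‖ ^ 2) γ₀ 4 M) :
    ∀ x : E, P₀ x = x → γ₀ / (8 * 100 ^ 5) / M ^ 5 * ‖x‖ ^ 2 ≤ ⟪H x, Δ₁ (H x)⟫ := by
  intro x hx
  have h := h19 x hx
  unfold B16Sect1Wilson.Ineq19 at h
  have hM5 : 0 < M ^ 5 := pow_pos hM 5
  have e : γ₀ / (2 * ((4 : ℕ) : ℝ) * (100 * M) ^ (4 + 1)) = γ₀ / (8 * 100 ^ 5) / M ^ 5 := by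
    push_cast
    rw [mul_pow, div_div]
    ring
  rw [e] at h
  exact h

end Inputs

/-- **`B₅` when the current is measured in `ℓ²` (cell GAPS G-B16-02).**  The p. 359 bound of the right-hand side is an
`ℓ²` bound; honestly `‖J_{k,Z}‖₂ ≤ cJ·M²·ε` (`|Λ| ≤ (100M)⁴` sites, pointwise `O(ε)`: r13's `B16.prop1_chain_M7`, exponent
7 = 5 + 2), so the hypothesis (m4) of `prop1Printed_of_model` with an `M`-free letter is not the `ℓ²` reading.  But `M` is
ONE constant of the whole procedure ([IV] p. 177: the cube size `M` is fixed with `R_k`, `L`): if `P.M i ≤ M₀` at every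
instance, the `ℓ²` reading `‖J i W‖ ≤ cJ·(P.M i)²·ε` still gives the statement of record with the instance-independent
`B₅ := 2·a·hst·(cJ·M₀²)/γ + b + 1` — (1.78) with print's exponent 5, the extra `M²` absorbed in `B₅` (*«The power M⁵ is
not the optimal one»*, p. 195). [cite: Balaban1989LargeFieldI, Prop. 1 (1.78) p.194, p.195; Balaban1989LargeFieldII,
p.359] -/
theorem prop1Printed_of_model_ell2 (P : B15.LFVar)
    {E : P.Inst → Type*} {F : P.Inst → Type*}
    [∀ i, NormedAddCommGroup (E i)] [∀ i, InnerProductSpace ℝ (E i)] [∀ i, FiniteDimensional ℝ (E i)]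
    [∀ i, NormedAddCommGroup (F i)] [∀ i, InnerProductSpace ℝ (F i)]
    (P₀ : ∀ i, P.Bdry i → (E i →ₗ[ℝ] E i)) (hP2 : ∀ i W x, P₀ i W (P₀ i W x) = P₀ i W x)
    (hPsa : ∀ i W x y, ⟪P₀ i W x, y⟫ = ⟪x, P₀ i W y⟫)
    (H : ∀ i, P.Bdry i → (E i →ₗ[ℝ] F i)) (Hst : ∀ i, P.Bdry i → (F i →ₗ[ℝ] E i))
    (hadj : ∀ i W (x : E i) (y : F i), ⟪H i W x, y⟫ = ⟪x, Hst i W y⟫)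
    (Δ₁ : ∀ i, P.Bdry i → (F i →ₗ[ℝ] F i)) (dV : ∀ i, P.Bdry i → F i → F i) (J : ∀ i, P.Bdry i → F i)
    (A : ∀ i, P.Bdry i → E i → ℝ)
    {γ h₁ hst cJ a b M₀ : ℝ} (hγ : 0 < γ) (hh₁ : 0 ≤ h₁) (hhst : 0 ≤ hst) (hcJ : 0 ≤ cJ) (ha : 0 ≤ a)
    (hb : 0 ≤ b) {ℓ ρ r eA : P.Inst → ℝ} (hℓ : ∀ i, 0 ≤ ℓ i) (hr : ∀ i, 0 < r i) (heA : ∀ i, 0 < eA i)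
    (hM : ∀ i, 1 ≤ P.M i) (hM₀ : ∀ i, P.M i ≤ M₀)
    (hpos : ∀ i W x, P₀ i W x = x → γ / P.M i ^ 5 * ‖x‖ ^ 2 ≤ ⟪H i W x, Δ₁ i W (H i W x)⟫)
    (hH : ∀ i W x, ‖H i W x‖ ≤ h₁ * ‖x‖) (hHst : ∀ i W z, ‖Hst i W z‖ ≤ hst * ‖z‖)
    (hdV0 : ∀ i W, dV i W 0 = 0)
    (hdV : ∀ i W (u v : F i), ‖u‖ ≤ ρ i → ‖v‖ ≤ ρ i → ‖dV i W u - dV i W v‖ ≤ ℓ i * ‖u - v‖)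
    (hρ : ∀ i, h₁ * r i ≤ ρ i) (hsmall : ∀ i, P.M i ^ 5 / γ * hst * ℓ i * h₁ ≤ 1 / 2)
    (hA : ∀ i W (X δ : E i), HasDerivAt (fun s : ℝ => A i W (X + s • δ))
      (⟪δ, Hst i W (J i W)⟫ + ⟪δ, Hst i W (Δ₁ i W (H i W X))⟫ + ⟪δ, Hst i W (dV i W (H i W X))⟫) 0)
    (hJ : ∀ i ε W, 0 < ε → P.Regular i ε W → ‖J i W‖ ≤ cJ * P.M i ^ 2 * ε)
    (rep : ∀ i, P.Bdry i → P.Orbit i → E i) (hrepP : ∀ i W O, P₀ i W (rep i W O) = rep i W O)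
    (hrepr : ∀ i W O, ‖rep i W O‖ ≤ r i) (hrep_inj : ∀ i W, Function.Injective (rep i W))
    (hrep_surj : ∀ i W (B : E i), P₀ i W B = B → ‖B‖ ≤ r i → ∃ O, rep i W O = B)
    (hcrit : ∀ i W O, P.IsCritical i W O ↔ ∀ δB : E i, P₀ i W δB = δB →
      ⟪δB, Hst i W (J i W)⟫ + ⟪δB, Hst i W (Δ₁ i W (H i W (rep i W O)))⟫ +
        ⟪δB, Hst i W (dV i W (H i W (rep i W O)))⟫ = 0)
    (hmin : ∀ i W O, (∀ O', A i W (rep i W O) ≤ A i W (rep i W O')) → P.IsMinimum i W O)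
    (hdev : ∀ i ε W O, 0 < ε → P.Regular i ε W → P.dev i O ≤ a * ‖rep i W O‖ + b * P.M i ^ 2 * ε)
    (hAn : ∀ i ε W, 0 < ε → ε ≤ eA i → P.Regular i ε W → P.AnalyticExt i ε W) :
    B15.Prop1Printed P := by
  -- the `ℓ²` letter `cJ·M²` is dominated by the `M`-free letter `cJ·M₀²`
  have hJ' : ∀ i ε W, 0 < ε → P.Regular i ε W → ‖J i W‖ ≤ cJ * M₀ ^ 2 * ε := by
    intro i ε W hε hW
    have hMi : P.M i ^ 2 ≤ M₀ ^ 2 := pow_le_pow_left₀ (zero_le_one.trans (hM i)) (hM₀ i) 2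
    calc ‖J i W‖ ≤ cJ * P.M i ^ 2 * ε := hJ i ε W hε hW
      _ ≤ cJ * M₀ ^ 2 * ε := mul_le_mul_of_nonneg_right (mul_le_mul_of_nonneg_left hMi hcJ) hε.le
  have hcJ' : 0 ≤ cJ * M₀ ^ 2 := mul_nonneg hcJ (sq_nonneg _)
  exact prop1Printed_of_model P P₀ hP2 hPsa H Hst hadj Δ₁ dV J A hγ hh₁ hhst hcJ' ha hb hℓ hr heA hM hpos hH hHst
    hdV0 hdV hρ hsmall hA hJ' rep hrepP hrepr hrep_inj hrep_surj hcrit hmin hdev hAn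

end Literature.MathematicalPhysics.QuantumFieldTheory.Balaban1983to89.B15Prop1FromModel
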